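import Summits.HodgeConjecture.CorCM.Census.CyclicCharacterEvenSpectator

/-!
# Cyclic characters, XXVIII: THE EVEN CERTIFICATE — `β − 1` faces generate for `w ↠ ℤ/2ᵏ` (`k ≥ 2`), EVEN kernel (no hypothesis on `d`)

COR-CM (cell `pub-hodgecm2`), count-neutral kernel combinatorics by the binder seat b09 (gen 43; lane CYCLIC-CHARACTER FIBRE LAW, part XXVIII), on parts XVI, XIX,
XXII–XXVII and XXVIa BY NAME.  The laws are read off in part XXIX (`Census/CyclicCharacterEvenSylowLaw.lean`).  Theorems only (no definition, no `decide`, no certificate, no named fact, no `sorry`).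
HONEST FRAMING: `HC_CM` is NOT proved, here or anywhere in the tree; nothing here is a period or a headline.

The laws are read off in part XXIX; here the CERTIFICATE (`exists_evenCert_generate`): for `w ↠ ℤ/2ᵏ` (`k ≥ 2`), `w c ≠ 0`, kernel of EVEN size `2m ≥ 4`,
`β − 1` faces whose base changes generate the Hodge lattice modulo pairs — the cover of every block of potential `≥ 2` except the block of the tie `X_C`
(gen 38/39), the downward face `gface X_C b b'`, the ascending tie face `gface X_C v v'`, the even three-across face `gface X_C^{(b)} b v` (parts XXV/XXVI:
`R(C)`, every `ζ`), and for every interior position `1 ≤ j ≤ 2ᵏ⁻¹ − 2` ONE vertical face at a spectator `u_j`, chosen AFTER the cover: the upper `gface X_C v u_j`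
if the cover linearises the spectator tie `X_C ∪ u_j` down, the lower `gface X_C^{(b)} b u_j` if up (part XXVII).  Unit shifts telescope (part XXII), the top
shift comes from `ζ` (part XXIII), part XVIʼs generation theorem closes; count `(β − 2ᵏ⁻¹ − 2) + 3 + (2ᵏ⁻¹ − 2) = β − 1` (near blocks by part XXVIa).
§1: a CM type is determined by its deviation set from any CM type (`eq_of_sdiff_eq`).

## References
* [Pohlmann1968] H. Pohlmann, Algebraic cycles on abelian varieties of complex multiplication type, Ann. of Math. 88 (1968), Thm 1.
* [Milne1999] J. S. Milne, Lefschetz motives and the Tate conjecture, Compositio Math. 117 (1999), Prop. 2.1, p. 54.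
-/

namespace Summit.HodgeConjecture.CorCM.Census.CyclicCharacter

open Finset
open Summit.HodgeConjecture.CorCM.Prior.AllgGroup.RfwfAllgGroup
open Summit.HodgeConjecture.CorCM.Census.BlockParity
open Summit.HodgeConjecture.CorCM.Census.Coinvariant
open Summit.HodgeConjecture.CorCM.Census.TwistGeneration
open Summit.HodgeConjecture.CorCM.Census.Nondegenerate
open Summit.HodgeConjecture.CorCM.Census.BaseBlock
open Summit.HodgeConjecture.CorCM.Census.Splitting

noncomputable section

variable {G : Type*} [Group G] [Fintype G] [DecidableEq G] {k : ℕ} {w : G → ZMod (2 ^ k)} {c : G}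

/-! ## §1 A CM type is determined by its deviation from any CM type -/

/-- **A CM type is determined by its deviation set** from a fixed CM type `T`: `T ∖ Ψ = T ∖ Ψ' ⇒ Ψ = Ψ'`. [folklore] -/
theorem eq_of_sdiff_eq {T Ψ Ψ' : CMF G c} (h : T.1 \ Ψ.1 = T.1 \ Ψ'.1) : Ψ = Ψ' := by
  have key : ∀ x ∈ T.1, x ∈ Ψ.1 ↔ x ∈ Ψ'.1 := fun x hxT => by
    constructor
    · intro hx; by_contra hx'
      have : x ∈ T.1 \ Ψ'.1 := mem_sdiff.mpr ⟨hxT, hx'⟩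
      rw [← h] at this; exact (mem_sdiff.mp this).2 hx
    · intro hx'; by_contra hx
      have : x ∈ T.1 \ Ψ.1 := mem_sdiff.mpr ⟨hxT, hx⟩
      rw [h] at this; exact (mem_sdiff.mp this).2 hx'
  apply Subtype.ext; ext x
  by_cases hxT : x ∈ T.1
  · exact key x hxT
  · have hcx : c * x ∈ T.1 := by by_contra h'; exact hxT (by have := T.2 x; tauto)
    rw [Ψ.2 x, Ψ'.2 x, not_iff_not]
    exact key (c * x) hcx

/-! ## §2 The even certificate generates -/

/-- **THE EVEN CERTIFICATE GENERATES, with `β − 1` faces** (no hypothesis on `d`): for `w ↠ ℤ/2ᵏ` (`k ≥ 2`), `w c ≠ 0`, kernel of EVEN size `2m ≥ 4`,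
there is a face family `S₀` with `|S₀| + 1 ≤ β(G, c)` whose base changes generate, with the pairs, the integer Hodge lattice. [folklore] -/
theorem exists_evenCert_generate [Fintype (CMF G c)] (hw : ∀ P Q : G, w (P * Q) = w P + w Q) (hk : 1 ≤ k) (hk2 : 2 ≤ k)
    (hc2 : c * c = 1) (hcen : ∀ x : G, x * c = c * x) (hwc : w c ≠ 0) (h1 : ∃ g₁ : G, w g₁ = 1)
    {m : ℕ} (hm : 2 * m = (univ.filter fun s : G => w s = 0).card) (hm2 : 2 ≤ m) :
    ∃ S₀ : Finset (CMF G c →₀ ℤ), (↑S₀ ⊆ gfaceSet G c hc2) ∧ S₀.card + 1 ≤ Fintype.card (Block c) ∧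
      hodgeSpan c hc2 ≤ Submodule.span ℤ (pairSet c) ⊔ Submodule.span ℤ (translates c S₀) := by
  classical
  have h2k : 2 ^ k = 2 * 2 ^ (k - 1) := by rw [← pow_succ', Nat.sub_add_cancel hk]
  have hh2 : 2 ≤ 2 ^ (k - 1) := le_trans (pow_one 2).symm.le (Nat.pow_le_pow_right (by norm_num) (by omega))
  obtain ⟨Qm, hQm⟩ := exists_apply_eq hw h1 (-1)
  have eT₁ : arcType hw hk hc2 hwc 1 = rt c Qm (arcType hw hk hc2 hwc 0) := arcType_eq_rt hw hk hc2 hwc hQm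
  have hT01 : arcType hw hk hc2 hwc 0 ≠ arcType hw hk hc2 hwc 1 := fun h => by
    haveI : NeZero (2 ^ k) := ⟨pow_ne_zero _ two_ne_zero⟩
    haveI : Fact (1 < 2 ^ k) := ⟨Nat.one_lt_two_pow (by omega)⟩
    exact zero_ne_one (arcType_injective hw hk hc2 hwc h1 h)
  have hn2 : 2 ≤ (univ.filter fun s : G => w s = 0).card := by omega
  -- `C ⊆ F_0` of size `m`, `b ≠ b' ∈ C`, `v ≠ v' ∈ F_0 ∖ C`
  obtain ⟨C, hCF, hCc⟩ := exists_subset_card_eq (s := (univ.filter fun s : G => w s = 0)) (n := m) (by omega)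
  have hCm : 2 * C.card = (univ.filter fun s : G => w s = 0).card := by rw [hCc]; exact hm
  have hC2 : 2 ≤ C.card := by omega
  obtain ⟨b, hb, b', hb', hbb'⟩ := one_lt_card.mp (by omega : 1 < C.card)
  have hUc : ((univ.filter fun s : G => w s = 0) \ C).card = m := by have := card_sdiff_add_card_eq_card hCF; omega
  obtain ⟨v, hv, v', hv', hvv'⟩ := one_lt_card.mp (by omega : 1 < ((univ.filter fun s : G => w s = 0) \ C).card)
  have hb0 : w b = 0 := (mem_filter.mp (hCF hb)).2
  have hb'0 : w b' = 0 := (mem_filter.mp (hCF hb')).2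
  have hv0 : w v = 0 := (mem_filter.mp (mem_sdiff.mp hv).1).2
  have hv'0 : w v' = 0 := (mem_filter.mp (mem_sdiff.mp hv').1).2
  have hvC : v ∉ C := (mem_sdiff.mp hv).2
  have hbv : b ≠ v := fun h => hvC (h ▸ hb)
  have hwc' : ∀ x : G, w x = 0 → ∀ y : G, w y = 0 → y ≠ c * x := fun x hx y hy h => hwc (by
    have := congrArg w h; rw [hw, hx, hy, add_zero] at this; exact this.symm)
  -- the tie `X = X_C`, `X' = X^{(b)}`
  obtain ⟨X, hX⟩ := exists_sdiff_eq_of_subset_fibre hw hk hc2 hwc C hCF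
  have hbT : b ∈ (arcType hw hk hc2 hwc 0).1 := (mem_arcType_zero_and_notMem_one hw hk hc2 hwc hb0).1
  have hbX : b ∉ X.1 := fun h => (mem_sdiff.mp (hX.symm ▸ hb : b ∈ (arcType hw hk hc2 hwc 0).1 \ X.1)).2 h
  have hX' : (arcType hw hk hc2 hwc 0).1 \ (oflipCM c hc2 b X).1 = C.erase b := by rw [dev_oflip c hc2 hbT hbX, hX]
  have hX'b : oflipCM c hc2 b (oflipCM c hc2 b X) = X := oflipCM_oflipCM_self c hc2 b X
  have h2X : 2 * ((arcType hw hk hc2 hwc 0).1 \ X.1).card = (univ.filter fun s : G => w s = 0).card := by rw [hX]; exact hCm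
  have hpotX : bpot c (arcType hw hk hc2 hwc 0) X = m := by rw [bpot_eq_of_tie hw hk hc2 hwc h2X, hX, hCc]
  -- spectators: a point at every position; those at positions `1 ≤ j ≤ 2ᵏ⁻¹ − 2` lie in `T_0 ∩ T_1 ∩ X`
  have hpt : ∀ j : ℕ, ∃ u : G, w u = (j : ZMod (2 ^ k)) := fun j => exists_apply_eq hw h1 _
  choose pt hpt using hpt
  have hptT : ∀ j, 1 ≤ j → j ≤ 2 ^ (k - 1) - 2 →
      pt j ∈ (arcType hw hk hc2 hwc 0).1 ∧ pt j ∈ (arcType hw hk hc2 hwc 1).1 ∧ w (pt j) ≠ 0 ∧ pt j ∈ X.1 := by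
    intro j hj1 hj2
    have hmem := mem_arcType_of_apply_eq_natCast hw hk hc2 hwc (hpt j) (by omega)
    have hne : w (pt j) ≠ 0 := by rw [hpt]; exact natCast_ne_zero_of_lt hj1 (by omega)
    refine ⟨hmem.1, hmem.2 hj1, hne, ?_⟩
    by_contra h
    exact hne (mem_filter.mp (hCF (by have := mem_sdiff.mpr ⟨hmem.1, h⟩; rwa [hX] at this))).2
  have hZdev : ∀ j, 1 ≤ j → j ≤ 2 ^ (k - 1) - 2 → (arcType hw hk hc2 hwc 0).1 \ (oflipCM c hc2 (pt j) X).1 = insert (pt j) C := by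
    intro j hj1 hj2
    rw [dev_oflip_of_mem c hc2 (hptT j hj1 hj2).1 (hptT j hj1 hj2).2.2.2, hX]
  have hZpot : ∀ j, 1 ≤ j → j ≤ 2 ^ (k - 1) - 2 → bpot c (arcType hw hk hc2 hwc 0) (oflipCM c hc2 (pt j) X) = C.card + 1 :=
    fun j hj1 hj2 => bpot_eq_of_spectatorTie hw hk hc2 hwc (hZdev j hj1 hj2) hCF hCm ⟨b, hb⟩ (hptT j hj1 hj2).2.2.1
  -- gen 38ʼs cover of the far blocks other than the block of the tie, and its data at the spectator ties
  obtain ⟨Sc, hScf, hScc, -, -, -, htwc⟩ := exists_joint_cover_on c (arcType hw hk hc2 hwc 0) hc2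
    (fun Bk : Block c => 2 ≤ bpot c (arcType hw hk hc2 hwc 0) Bk.out ∧ Bk ≠ blk c X) (fun _ h => h.1) ∅
    (by rw [Finset.coe_empty]; exact linearIndepOn_empty _ _) (fun f hf => absurd hf (Finset.notMem_empty f))
  have hdat : ∀ j : ℕ, ∃ τ : G × G × G, (1 ≤ j → j ≤ 2 ^ (k - 1) - 2 →
      bpot c (arcType hw hk hc2 hwc 0) (oflipCM c hc2 (pt j) X) = ddist (rt c τ.1 (arcType hw hk hc2 hwc 0)) (oflipCM c hc2 (pt j) X) ∧
        τ.2.1 ∈ (rt c τ.1 (arcType hw hk hc2 hwc 0)).1 \ (oflipCM c hc2 (pt j) X).1 ∧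
          τ.2.2 ∈ (rt c τ.1 (arcType hw hk hc2 hwc 0)).1 \ (oflipCM c hc2 (pt j) X).1 ∧ τ.2.1 ≠ τ.2.2 ∧
            gface c hc2 (oflipCM c hc2 (pt j) X) τ.2.1 τ.2.2 ∈ Submodule.span ℤ (translates c Sc)) := by
    intro j
    by_cases hj : 1 ≤ j ∧ j ≤ 2 ^ (k - 1) - 2
    · have hfar : 2 ≤ bpot c (arcType hw hk hc2 hwc 0) (blk c (oflipCM c hc2 (pt j) X)).out ∧ blk c (oflipCM c hc2 (pt j) X) ≠ blk c X := by
        rw [bpot_out, hZpot j hj.1 hj.2]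
        exact ⟨by omega, fun h => blk_ne_of_bpot_lt c (arcType hw hk hc2 hwc 0) (by rw [hpotX, hZpot j hj.1 hj.2, hCc]; omega) h.symm⟩
      obtain ⟨Q, s, s', hQ, hs, hs', hss', hf⟩ := htwc _ le_rfl (oflipCM c hc2 (pt j) X) hfar
      exact ⟨(Q, s, s'), fun _ _ => ⟨hQ, hs, hs', hss', hf⟩⟩
    · exact ⟨(1, 1, 1), fun h h' => absurd ⟨h, h'⟩ hj⟩
  choose τ hτ using hdat
  -- the vertical faces, chosen by the orientation of the cover at the spectator ties
  set vf : ℕ → (CMF G c →₀ ℤ) := fun j =>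
    if rt c (τ j).1 (arcType hw hk hc2 hwc 0) = arcType hw hk hc2 hwc 1 then gface c hc2 (oflipCM c hc2 b X) b (pt j)
    else gface c hc2 X v (pt j) with hvf
  set Gs : Finset (CMF G c →₀ ℤ) := (Icc 1 (2 ^ (k - 1) - 2)).image vf with hGs
  have hfown : gface c hc2 X b b' ∈ gfaceSet G c hc2 := ⟨X, b, b', by rw [mem_orb]; push Not; exact ⟨hbb'.symm, hwc' b hb0 b' hb'0⟩, rfl⟩
  have hfasc : gface c hc2 X v v' ∈ gfaceSet G c hc2 := ⟨X, v, v', by rw [mem_orb]; push Not; exact ⟨hvv'.symm, hwc' v hv0 v' hv'0⟩, rfl⟩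
  have hf3 : gface c hc2 (oflipCM c hc2 b X) b v ∈ gfaceSet G c hc2 :=
    ⟨oflipCM c hc2 b X, b, v, by rw [mem_orb]; push Not; exact ⟨hbv.symm, hwc' b hb0 v hv0⟩, rfl⟩
  have hptorb : ∀ j, 1 ≤ j → j ≤ 2 ^ (k - 1) - 2 → ∀ x : G, w x = 0 → pt j ∉ orb c x := by
    intro j hj1 hj2 x hx
    obtain ⟨huT0, -, hu0, -⟩ := hptT j hj1 hj2
    rw [mem_orb]; push Not
    refine ⟨fun h => hu0 (h ▸ hx), fun h => ?_⟩
    have := (mem_arcType hw hk hc2 hwc 0 (pt j)).mp huT0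
    rw [h, hw, hx, add_zero, sub_zero, val_apply_c hw hk hc2 hwc] at this
    exact lt_irrefl _ this
  have hvfmem : ∀ j, 1 ≤ j → j ≤ 2 ^ (k - 1) - 2 → vf j ∈ gfaceSet G c hc2 := by
    intro j hj1 hj2
    rw [hvf]; dsimp only; split_ifs
    · exact ⟨_, b, pt j, hptorb j hj1 hj2 b hb0, rfl⟩
    · exact ⟨_, v, pt j, hptorb j hj1 hj2 v hv0, rfl⟩
  set S₀ : Finset (CMF G c →₀ ℤ) := (Sc ∪ {gface c hc2 X b b', gface c hc2 X v v', gface c hc2 (oflipCM c hc2 b X) b v}) ∪ Gs with hS₀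
  have hS₀f : (↑S₀ : Set (CMF G c →₀ ℤ)) ⊆ gfaceSet G c hc2 := by
    intro f hf
    rw [hS₀, coe_union, coe_union, Set.mem_union, Set.mem_union] at hf
    rcases hf with (hf | hf) | hf
    · exact hScf hf
    · simp only [coe_insert, coe_singleton, Set.mem_insert_iff, Set.mem_singleton_iff] at hf
      rcases hf with rfl | rfl | rfl; exacts [hfown, hfasc, hf3]
    · rw [hGs, coe_image] at hf
      obtain ⟨j, hj, rfl⟩ := hf
      rw [coe_Icc, Set.mem_Icc] at hj; exact hvfmem j hj.1 hj.2
  have hScS : Sc ⊆ S₀ := subset_union_left.trans subset_union_left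
  have hmemS : ∀ f ∈ ({gface c hc2 X b b', gface c hc2 X v v', gface c hc2 (oflipCM c hc2 b X) b v} : Finset (CMF G c →₀ ℤ)), f ∈ S₀ :=
    fun f hf => by rw [hS₀]; exact mem_union_left _ (mem_union_right _ hf)
  have hownS : gface c hc2 X b b' ∈ S₀ := hmemS _ (mem_insert_self _ _)
  have hascS : gface c hc2 X v v' ∈ S₀ := hmemS _ (mem_insert_of_mem (mem_insert_self _ _))
  have h3S : gface c hc2 (oflipCM c hc2 b X) b v ∈ S₀ := hmemS _ (mem_insert_of_mem (mem_insert_of_mem (mem_singleton_self _)))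
  have hvfS : ∀ j, 1 ≤ j → j ≤ 2 ^ (k - 1) - 2 → vf j ∈ S₀ :=
    fun j hj1 hj2 => by rw [hS₀, hGs]; exact mem_union_right _ (mem_image_of_mem _ (mem_Icc.mpr ⟨hj1, hj2⟩))
  have hsubSc : Submodule.span ℤ (translates c Sc) ≤ Submodule.span ℤ (pairSet c) ⊔ Submodule.span ℤ (translates c S₀) :=
    (Submodule.span_mono fun y hy => by obtain ⟨Q, f, hf, e⟩ := hy; exact ⟨Q, f, hScS hf, e⟩).trans le_sup_right
  -- the toward property
  have htw : ∀ Φ : CMF G c, 2 ≤ bpot c (arcType hw hk hc2 hwc 0) Φ → ∃ Q s s' : G, bpot c (arcType hw hk hc2 hwc 0) Φ = ddist (rt c Q (arcType hw hk hc2 hwc 0)) Φ ∧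
      s ∈ (rt c Q (arcType hw hk hc2 hwc 0)).1 \ Φ.1 ∧ s' ∈ (rt c Q (arcType hw hk hc2 hwc 0)).1 \ Φ.1 ∧ s ≠ s' ∧
        gface c hc2 Φ s s' ∈ Submodule.span ℤ (pairSet c) ⊔ Submodule.span ℤ (translates c S₀) := by
    refine toward_all_of_on c (arcType hw hk hc2 hwc 0) hc2 (fun Bk : Block c => 2 ≤ bpot c (arcType hw hk hc2 hwc 0) Bk.out ∧ Bk ≠ blk c X) _ ?_ ?_
    · exact fun Φ hΦ => htwc _ hsubSc Φ hΦ
    · intro Φ hΦ hnot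
      have hblk : blk c Φ = blk c X := by by_contra h; exact hnot ⟨by rw [bpot_out]; exact hΦ, h⟩
      refine toward_of_explicit c (arcType hw hk hc2 hwc 0) hc2 _ (Q₀ := 1) (t := b) (t' := b')
        (by rw [rt_one, bpot_eq_of_tie hw hk hc2 hwc h2X]; rfl) (by rw [rt_one, hX]; exact hb) (by rw [rt_one, hX]; exact hb') hbb' ?_ hblk
      exact fun Q => Submodule.mem_sup_right (Submodule.subset_span ⟨Q, _, hownS, rfl⟩)
  have hcov := fun Φ => hcov_of_toward c (arcType hw hk hc2 hwc 0) hc2 S₀ htw Φ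
  have hL := fun f (hf : f ∈ S₀) => (Submodule.mem_sup_right (mem_span_translates_of_mem c S₀ hf) :
    f ∈ Submodule.span ℤ (pairSet c) ⊔ Submodule.span ℤ (translates c S₀))
  set L := Submodule.span ℤ (pairSet c) ⊔ Submodule.span ℤ (translates c S₀) with hLdef
  -- `R(C)`, every `ζ`, the fibre sum; `X` down and up
  obtain ⟨hR, hζ⟩ := rel_and_zeta_of_evenCert hw hk hk2 hc2 hcen hwc h1 S₀ htw hCF hCm hC2 hX hb hb' hbb' hv hv' hvv'
    (hL _ hownS) (hL _ hascS) (hL _ h3S)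
  have hfib := fib_mem_of_rel hw hk hc2 hwc _ hCF hR fun s hs => hζ s (mem_filter.mp (mem_sdiff.mp hs).1).2
  have eC := single_sub_normalForm_mem_of_face hw hk hc2 hwc L htw 1 (Φ := X)
    (by rw [rt_one]; unfold ddist; rw [hX]; omega) (by rw [rt_one, hX]; exact hb) (by rw [rt_one, hX]; exact hb') hbb' (hL _ hownS)
  rw [rt_one] at eC
  have hT1X := sdiff_arcType_one_eq_image hw hk hc2 hwc X (hX.symm ▸ hCF)
  rw [hX] at hT1X
  have eCup : Finsupp.single X (1 : ℤ) - ((∑ s ∈ (arcType hw hk hc2 hwc 1).1 \ X.1,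
      (Finsupp.single (oflipCM c hc2 s (arcType hw hk hc2 hwc 1)) (1 : ℤ) - Finsupp.single (arcType hw hk hc2 hwc 1) 1)) +
        Finsupp.single (arcType hw hk hc2 hwc 1) 1) ∈ L := by
    rw [normalForm_one_eq hw hk hc2 hwc X (hX.symm ▸ hCF), hX]
    have h := Submodule.add_mem _ eC hR
    rw [hX] at h
    convert h using 1
    abel
  have hwcs : ∀ u : G, u ∈ (arcType hw hk hc2 hwc 0).1 → ∀ s : G, w s = 0 → w (c * s) ≠ w u := by
    intro u huT0 s hs h
    rw [hw, hs, add_zero, apply_c hw hk hc2 hwc] at h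
    have := (mem_arcType hw hk hc2 hwc 0 u).mp huT0
    rw [sub_zero, ← h, val_two_pow_pred hk] at this; exact lt_irrefl _ this
  -- every type deviating from `T_0` inside `C ∪ {u}` by at most `m` places is linearised down (the plain tie `X` by its face, the rest by uniqueness)
  have hlinD : ∀ u : G, w u ≠ 0 → ∀ Ψ : CMF G c, (arcType hw hk hc2 hwc 0).1 \ Ψ.1 ⊆ insert u C → ((arcType hw hk hc2 hwc 0).1 \ Ψ.1).card ≤ C.card →
      Finsupp.single Ψ (1 : ℤ) - ((∑ s ∈ (arcType hw hk hc2 hwc 0).1 \ Ψ.1,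
        (Finsupp.single (oflipCM c hc2 s (arcType hw hk hc2 hwc 0)) (1 : ℤ) - Finsupp.single (arcType hw hk hc2 hwc 0) 1)) +
          Finsupp.single (arcType hw hk hc2 hwc 0) 1) ∈ L := by
    intro u hu0 Ψ hsub hcard
    by_cases hD : (arcType hw hk hc2 hwc 0).1 \ Ψ.1 = C
    · rw [eq_of_sdiff_eq (hD.trans hX.symm)]; exact eC
    · have hU := unique_base_zero hw hk hc2 hwc (Φ := Ψ) (by omega) (fun hle => ?_) hn2
      · have e := single_sub_normalForm_mem_of_toward_of_unique hw hk hc2 hwc L htw 1 Ψ hU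
        rwa [rt_one] at e
      have hDm : ((arcType hw hk hc2 hwc 0).1 \ Ψ.1).card = C.card := by omega
      have huD : u ∈ (arcType hw hk hc2 hwc 0).1 \ Ψ.1 := by
        by_contra h
        exact hD (eq_of_subset_of_card_le (fun x hx => (mem_insert.mp (hsub hx)).resolve_left fun e => h (e ▸ hx)) (by omega))
      obtain ⟨x, hx⟩ : (((arcType hw hk hc2 hwc 0).1 \ Ψ.1).erase u).Nonempty := by
        rw [← card_pos]; have := card_erase_add_one huD; omega
      have hxC : x ∈ C := (mem_insert.mp (hsub (mem_of_mem_erase hx))).resolve_left (ne_of_mem_erase hx)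
      exact ⟨u, huD, x, mem_of_mem_erase hx, fun h => hu0 (h.trans (mem_filter.mp (hCF hxC)).2)⟩
  -- … and inside `c·(F_0 ∖ C) ∪ {u}` (the `T_1`-deviation of the spectator tie) up
  have hlinU : ∀ u : G, u ∈ (arcType hw hk hc2 hwc 0).1 → ∀ Ψ : CMF G c,
      (arcType hw hk hc2 hwc 1).1 \ Ψ.1 ⊆ insert u ((((univ.filter fun s : G => w s = 0)) \ C).image fun s => c * s) →
      ((arcType hw hk hc2 hwc 1).1 \ Ψ.1).card ≤ C.card →
      Finsupp.single Ψ (1 : ℤ) - ((∑ s ∈ (arcType hw hk hc2 hwc 1).1 \ Ψ.1,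
        (Finsupp.single (oflipCM c hc2 s (arcType hw hk hc2 hwc 1)) (1 : ℤ) - Finsupp.single (arcType hw hk hc2 hwc 1) 1)) +
          Finsupp.single (arcType hw hk hc2 hwc 1) 1) ∈ L := by
    intro u huT0 Ψ hsub hcard
    by_cases hD : (arcType hw hk hc2 hwc 1).1 \ Ψ.1 = (((univ.filter fun s : G => w s = 0)) \ C).image fun s => c * s
    · rw [eq_of_sdiff_eq (hD.trans hT1X.symm)]; exact eCup
    · have hcardC : ((((univ.filter fun s : G => w s = 0)) \ C).image fun s => c * s).card = C.card := by
        rw [card_image_of_injective _ (mul_right_injective c), hUc, hCc]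
      have hU : ∀ Ω : CMF G c, (rt c Qm (arcType hw hk hc2 hwc 0)).1 \ Ω.1 ⊆ (rt c Qm (arcType hw hk hc2 hwc 0)).1 \ Ψ.1 →
          ∀ Q : G, bpot c (arcType hw hk hc2 hwc 0) Ω = ddist (rt c Q (arcType hw hk hc2 hwc 0)) Ω → rt c Q (arcType hw hk hc2 hwc 0) = rt c Qm (arcType hw hk hc2 hwc 0) := by
        refine unique_of_sdiff_small hw hk hc2 hwc (by rw [← eT₁]; omega) (fun hle => ?_) hn2
        rw [← eT₁] at hle ⊢
        have hDm : ((arcType hw hk hc2 hwc 1).1 \ Ψ.1).card = C.card := by omega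
        have huD : u ∈ (arcType hw hk hc2 hwc 1).1 \ Ψ.1 := by
          by_contra h
          exact hD (eq_of_subset_of_card_le (fun x hx => (mem_insert.mp (hsub hx)).resolve_left fun e => h (e ▸ hx)) (by omega))
        obtain ⟨y, hy⟩ : (((arcType hw hk hc2 hwc 1).1 \ Ψ.1).erase u).Nonempty := by
          rw [← card_pos]; have := card_erase_add_one huD; omega
        have hyC : y ∈ (((univ.filter fun s : G => w s = 0)) \ C).image fun s => c * s :=
          (mem_insert.mp (hsub (mem_of_mem_erase hy))).resolve_left (ne_of_mem_erase hy)
        obtain ⟨s, hs, rfl⟩ := mem_image.mp hyC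
        exact ⟨u, huD, c * s, mem_of_mem_erase hy, fun h => hwcs u huT0 s (mem_filter.mp (mem_sdiff.mp hs).1).2 h.symm⟩
      have e := single_sub_normalForm_mem_of_toward_of_unique hw hk hc2 hwc L htw Qm Ψ hU
      rwa [← eT₁] at e
  -- the unit arc shift at every interior position
  have hunit : ∀ j : ℕ, 1 ≤ j → j ≤ 2 ^ (k - 1) - 2 → ∃ u₀ : G, w u₀ = (j : ZMod (2 ^ k)) ∧
      (Finsupp.single (oflipCM c hc2 u₀ (arcType hw hk hc2 hwc 0)) (1 : ℤ) - Finsupp.single (arcType hw hk hc2 hwc 0) 1) -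
        (Finsupp.single (oflipCM c hc2 u₀ (arcType hw hk hc2 hwc 1)) (1 : ℤ) - Finsupp.single (arcType hw hk hc2 hwc 1) 1) ∈ L := by
    intro j hj1 hj2
    obtain ⟨huT0, huT1, hu0, huX⟩ := hptT j hj1 hj2
    have hZ := hZdev j hj1 hj2
    have huC : pt j ∉ C := fun h => hu0 (mem_filter.mp (hCF h)).2
    obtain ⟨hQ, hs, hs', hss', hfQ⟩ := hτ j hj1 hj2
    have hfL : gface c hc2 (oflipCM c hc2 (pt j) X) (τ j).2.1 (τ j).2.2 ∈ L := hsubSc hfQ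
    have hQd : ddist (rt c (τ j).1 (arcType hw hk hc2 hwc 0)) (oflipCM c hc2 (pt j) X) = C.card + 1 := by rw [← hQ, hZpot j hj1 hj2]
    refine ⟨pt j, hpt j, ?_⟩
    rcases rt_arcType_eq_zero_or_one_of_spectatorTie hw hk hk2 hc2 hwc h1 hZ hCF hCm hC2 hu0 hQd with hdown | hup
    · -- the spectator tie is DOWN: linearise it through the coverʼs face, use the UPPER vertical face
      rw [hdown] at hs hs'
      have hds : (arcType hw hk hc2 hwc 0).1 \ (oflipCM c hc2 (τ j).2.1 (oflipCM c hc2 (pt j) X)).1 = (insert (pt j) C).erase (τ j).2.1 := by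
        rw [dev_oflip c hc2 (mem_sdiff.mp hs).1 (mem_sdiff.mp hs).2, hZ]
      have hds' : (arcType hw hk hc2 hwc 0).1 \ (oflipCM c hc2 (τ j).2.2 (oflipCM c hc2 (pt j) X)).1 = (insert (pt j) C).erase (τ j).2.2 := by
        rw [dev_oflip c hc2 (mem_sdiff.mp hs').1 (mem_sdiff.mp hs').2, hZ]
      have hsm : (τ j).2.1 ∈ (arcType hw hk hc2 hwc 0).1 \ (oflipCM c hc2 (τ j).2.2 (oflipCM c hc2 (pt j) X)).1 := by
        rw [hds']; exact mem_erase.mpr ⟨hss', hZ ▸ hs⟩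
      have hdss' : (arcType hw hk hc2 hwc 0).1 \ (oflipCM c hc2 (τ j).2.1 (oflipCM c hc2 (τ j).2.2 (oflipCM c hc2 (pt j) X))).1 =
          ((insert (pt j) C).erase (τ j).2.2).erase (τ j).2.1 := by
        rw [dev_oflip c hc2 (mem_sdiff.mp hsm).1 (mem_sdiff.mp hsm).2, hds']
      have hcZ : (insert (pt j) C).card = C.card + 1 := card_insert_of_notMem huC
      have hsD : (τ j).2.1 ∈ insert (pt j) C := hZ ▸ hs
      have hs'D : (τ j).2.2 ∈ insert (pt j) C := hZ ▸ hs'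
      have e₃ := hlinD (pt j) hu0 _ (by rw [hds]; exact erase_subset _ _) (by rw [hds]; have := card_erase_add_one hsD; omega)
      have e₄ := hlinD (pt j) hu0 _ (by rw [hds']; exact erase_subset _ _) (by rw [hds']; have := card_erase_add_one hs'D; omega)
      have e₂ := hlinD (pt j) hu0 _ (by rw [hdss']; exact (erase_subset _ _).trans (erase_subset _ _))
        (by rw [hdss']; have := card_erase_add_one hs'D; have := card_erase_le (s := (insert (pt j) C).erase (τ j).2.2) (a := (τ j).2.1); omega)
      have eZ := single_sub_normalForm_mem_of_face_of_mems hc2 L (arcType hw hk hc2 hwc 0) hs hs' hss' hfL e₂ e₃ e₄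
      have hvfj : vf j = gface c hc2 X v (pt j) := by
        rw [hvf]; dsimp only; rw [if_neg]; rw [hdown]; exact hT01
      have hfv : gface c hc2 X v (pt j) ∈ L := by rw [← hvfj]; exact hL _ (hvfS j hj1 hj2)
      exact unitShift_mem_of_upperVertical hw hk hc2 hwc h1 L htw hX hCF hCm hC2 hv hu0 huT0 huT1 hfv eC eZ
    · -- the spectator tie is UP: linearise it through the coverʼs face, use the LOWER vertical face
      rw [hup] at hs hs'
      have hZ1 : (arcType hw hk hc2 hwc 1).1 \ (oflipCM c hc2 (pt j) X).1 = insert (pt j) ((((univ.filter fun s : G => w s = 0)) \ C).image fun s => c * s) :=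
        sdiff_arcType_one_eq_of_spectator hw hk hc2 hwc _ hZ hCF huT1 hu0
      have huC' : pt j ∉ ((((univ.filter fun s : G => w s = 0)) \ C).image fun s => c * s) := by
        rw [mem_image]; rintro ⟨s, hs0, h⟩
        exact hwcs (pt j) huT0 s (mem_filter.mp (mem_sdiff.mp hs0).1).2 (by rw [h])
      have hcardC : ((((univ.filter fun s : G => w s = 0)) \ C).image fun s => c * s).card = C.card := by
        rw [card_image_of_injective _ (mul_right_injective c), hUc, hCc]
      have hds : (arcType hw hk hc2 hwc 1).1 \ (oflipCM c hc2 (τ j).2.1 (oflipCM c hc2 (pt j) X)).1 =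
          (insert (pt j) ((((univ.filter fun s : G => w s = 0)) \ C).image fun s => c * s)).erase (τ j).2.1 := by
        rw [dev_oflip c hc2 (mem_sdiff.mp hs).1 (mem_sdiff.mp hs).2, hZ1]
      have hds' : (arcType hw hk hc2 hwc 1).1 \ (oflipCM c hc2 (τ j).2.2 (oflipCM c hc2 (pt j) X)).1 =
          (insert (pt j) ((((univ.filter fun s : G => w s = 0)) \ C).image fun s => c * s)).erase (τ j).2.2 := by
        rw [dev_oflip c hc2 (mem_sdiff.mp hs').1 (mem_sdiff.mp hs').2, hZ1]
      have hsm : (τ j).2.1 ∈ (arcType hw hk hc2 hwc 1).1 \ (oflipCM c hc2 (τ j).2.2 (oflipCM c hc2 (pt j) X)).1 := by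
        rw [hds']; exact mem_erase.mpr ⟨hss', hZ1 ▸ hs⟩
      have hdss' : (arcType hw hk hc2 hwc 1).1 \ (oflipCM c hc2 (τ j).2.1 (oflipCM c hc2 (τ j).2.2 (oflipCM c hc2 (pt j) X))).1 =
          ((insert (pt j) ((((univ.filter fun s : G => w s = 0)) \ C).image fun s => c * s)).erase (τ j).2.2).erase (τ j).2.1 := by
        rw [dev_oflip c hc2 (mem_sdiff.mp hsm).1 (mem_sdiff.mp hsm).2, hds']
      have hcZ : (insert (pt j) ((((univ.filter fun s : G => w s = 0)) \ C).image fun s => c * s)).card = C.card + 1 := by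
        rw [card_insert_of_notMem huC', hcardC]
      have hsD : (τ j).2.1 ∈ insert (pt j) ((((univ.filter fun s : G => w s = 0)) \ C).image fun s => c * s) := hZ1 ▸ hs
      have hs'D : (τ j).2.2 ∈ insert (pt j) ((((univ.filter fun s : G => w s = 0)) \ C).image fun s => c * s) := hZ1 ▸ hs'
      have e₃ := hlinU (pt j) huT0 _ (by rw [hds]; exact erase_subset _ _) (by rw [hds]; have := card_erase_add_one hsD; omega)
      have e₄ := hlinU (pt j) huT0 _ (by rw [hds']; exact erase_subset _ _) (by rw [hds']; have := card_erase_add_one hs'D; omega)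
      have e₂ := hlinU (pt j) huT0 _ (by rw [hdss']; exact (erase_subset _ _).trans (erase_subset _ _))
        (by rw [hdss']; have := card_erase_add_one hs'D;
            have := card_erase_le (s := (insert (pt j) ((((univ.filter fun s : G => w s = 0)) \ C).image fun s => c * s)).erase (τ j).2.2) (a := (τ j).2.1); omega)
      have eZ := single_sub_normalForm_mem_of_face_of_mems hc2 L (arcType hw hk hc2 hwc 1) hs hs' hss' hfL e₂ e₃ e₄
      have hvfj : vf j = gface c hc2 (oflipCM c hc2 b X) b (pt j) := by
        rw [hvf]; dsimp only; rw [if_pos hup]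
      have hfv : gface c hc2 (oflipCM c hc2 b X) b (pt j) ∈ L := by rw [← hvfj]; exact hL _ (hvfS j hj1 hj2)
      have hZ' : oflipCM c hc2 b (oflipCM c hc2 (pt j) (oflipCM c hc2 b X)) = oflipCM c hc2 (pt j) X := by
        rw [oflipCM_oflipCM_comm c hc2 b (pt j), oflipCM_oflipCM_self]
      have eC' : Finsupp.single (oflipCM c hc2 b (oflipCM c hc2 b X)) (1 : ℤ) - ((∑ s ∈ (arcType hw hk hc2 hwc 0).1 \ (oflipCM c hc2 b (oflipCM c hc2 b X)).1,
          (Finsupp.single (oflipCM c hc2 s (arcType hw hk hc2 hwc 0)) (1 : ℤ) - Finsupp.single (arcType hw hk hc2 hwc 0) 1)) +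
            Finsupp.single (arcType hw hk hc2 hwc 0) 1) ∈ L := by rw [hX'b]; exact eC
      have eZ' : Finsupp.single (oflipCM c hc2 b (oflipCM c hc2 (pt j) (oflipCM c hc2 b X))) (1 : ℤ) -
          ((∑ s ∈ (arcType hw hk hc2 hwc 1).1 \ (oflipCM c hc2 b (oflipCM c hc2 (pt j) (oflipCM c hc2 b X))).1,
            (Finsupp.single (oflipCM c hc2 s (arcType hw hk hc2 hwc 1)) (1 : ℤ) - Finsupp.single (arcType hw hk hc2 hwc 1) 1)) +
              Finsupp.single (arcType hw hk hc2 hwc 1) 1) ∈ L := by rw [hZ']; exact eZ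
      exact unitShift_mem_of_lowerVertical hw hk hc2 hwc h1 L htw hb hX' hCF hCm hC2 hu0 huT0 huT1 hfv eC' eZ' hR
  -- the arc shifts: unit shifts telescope at the interior positions, `ζ` gives the top position
  have hshift : ∀ s ∈ ((arcType hw hk hc2 hwc 0)).1,
      Finsupp.single (oflipCM c hc2 s (arcType hw hk hc2 hwc 0)) (1 : ℤ) - Finsupp.single (arcType hw hk hc2 hwc 0) 1 -
        Finsupp.single (oflipCM c hc2 s (arcType hw hk hc2 hwc (w s))) 1 + Finsupp.single (arcType hw hk hc2 hwc (w s)) 1 ∈ L := by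
    intro s hs
    have hsv : (w s).val < 2 ^ (k - 1) := by have := (mem_arcType hw hk hc2 hwc 0 s).mp hs; rwa [sub_zero] at this
    have hws : w s = (((w s).val : ℕ) : ZMod (2 ^ k)) := (ZMod.natCast_zmod_val (w s)).symm
    by_cases htop : (w s).val = 2 ^ (k - 1) - 1
    · have hu : w s = ((2 ^ (k - 1) : ℕ) : ZMod (2 ^ k)) - 1 := by
        rw [hws, htop, Nat.cast_sub (Nat.one_le_two_pow), Nat.cast_one]
      exact shiftTop_mem_of_zeta_mem hw hk hc2 hcen hwc S₀ hb0 hu (hζ b hb0)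
    · have hle : (w s).val ≤ 2 ^ (k - 1) - 2 := by omega
      have h := shift_mem_of_unitShifts hw hk hc2 hcen hwc h1 S₀ (w s).val (fun j hj1 hj2 => hunit j hj1 (hj2.trans hle)) s hws
      rwa [← hws] at h
  -- the count `|S₀| ≤ (β − 2ᵏ⁻¹ − 1 − 1) + 3 + (2ᵏ⁻¹ − 2) = φ₂`
  obtain ⟨n₀, n₁, hn₀1, hn₁1, hn₀₁, hn₀, hn₁⟩ := exists_two_ker hw (by omega)
  have hnear := half_add_one_le_card_filter_bpot_le_one' hw hk hc2 hcen hwc h1 hn₀1 hn₁1 hn₀₁ hn₀ hn₁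
  have hsplit := card_filter_add_card_filter_not (s := (univ : Finset (Block c))) (fun Bk : Block c => 2 ≤ bpot c (arcType hw hk hc2 hwc 0) Bk.out)
  have hneg : (univ.filter fun Bk : Block c => ¬ 2 ≤ bpot c (arcType hw hk hc2 hwc 0) Bk.out) = univ.filter fun Bk : Block c => bpot c (arcType hw hk hc2 hwc 0) Bk.out ≤ 1 :=
    filter_congr fun Bk _ => by omega
  rw [hneg, card_univ] at hsplit
  have hfar : (univ.filter fun Bk : Block c => 2 ≤ bpot c (arcType hw hk hc2 hwc 0) Bk.out ∧ Bk ≠ blk c X) =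
      (univ.filter fun Bk : Block c => 2 ≤ bpot c (arcType hw hk hc2 hwc 0) Bk.out).erase (blk c X) := by
    ext Bk
    simp only [mem_filter, mem_univ, true_and, mem_erase]
    tauto
  have hXfar : blk c X ∈ univ.filter fun Bk : Block c => 2 ≤ bpot c (arcType hw hk hc2 hwc 0) Bk.out := by
    rw [mem_filter, bpot_out, hpotX]; exact ⟨mem_univ _, hm2⟩
  have hfarc := card_erase_add_one hXfar
  rw [← hfar] at hfarc
  have hcard : S₀.card + 1 ≤ Fintype.card (Block c) := by
    have h3 : ({gface c hc2 X b b', gface c hc2 X v v', gface c hc2 (oflipCM c hc2 b X) b v} : Finset (CMF G c →₀ ℤ)).card ≤ 3 :=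
      (card_insert_le _ _).trans (by have := card_insert_le (gface c hc2 X v v') ({gface c hc2 (oflipCM c hc2 b X) b v} : Finset (CMF G c →₀ ℤ)); rw [card_singleton] at this; omega)
    have hun := card_union_le Sc ({gface c hc2 X b b', gface c hc2 X v v', gface c hc2 (oflipCM c hc2 b X) b v} : Finset (CMF G c →₀ ℤ))
    have hG : Gs.card ≤ 2 ^ (k - 1) - 2 := by rw [hGs]; exact card_image_le.trans (by rw [Nat.card_Icc]; omega)
    have hu2 := card_union_le (Sc ∪ {gface c hc2 X b b', gface c hc2 X v v', gface c hc2 (oflipCM c hc2 b X) b v}) Gs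
    rw [← hS₀] at hu2
    rw [hScc] at hun
    omega
  exact ⟨S₀, hS₀f, hcard, hodgeSpan_le_psp_of_shift hw hk hc2 hcen hwc h1 S₀ (hS₀f.trans (gfaceSet_subset_hodgeSpan c hc2)) hcov hshift hfib⟩

end

end Summit.HodgeConjecture.CorCM.Census.CyclicCharacter
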